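import Literature.MathematicalPhysics.KineticTheory.GoodConfigurationsMeasure
import Literature.MathematicalPhysics.KineticTheory.HardSphereHierarchyModel
import Literature.MathematicalPhysics.KineticTheory.HierarchyComparison
import Literature.MathematicalPhysics.KineticTheory.TaggedBoltzmannPruning
import HarnessLib

/-!
# The coupling of the BBGKY and Boltzmann pseudo-trajectories (BGSR Proposition 5.3)
(Bodineau–Gallagher–Saint-Raymond, Invent. Math. 203 (2016) = arXiv:1305.3397v2, §5.1 "Reformulation
in terms of pseudo-trajectories" (5.2), §5.2.2 "Induction procedure for the pseudo-trajectories",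
Proposition 5.3 and its proof, (5.16)–(5.17), pp. 15–19 of the held text; trunk T-KINETIC, topic
MathematicalPhysics/KineticTheory; the CONCRETE coupling relation of the comparison step of the
bottom-up plan towards the named fact `bgsr_linearBoltzmannApprox` (`TaggedSphereDiffusion`),
recorded in `TaggedSphereLinearBoltzmannRate`, instantiating the abstract `HierarchyModel.Coupling`
of `HierarchyComparison` for the hard-sphere model `hsHierarchyModel` (transports: the regularised
Alexander flows; collision operators read at outgoing representatives `outRep`) and the Boltzmann
model on `T^d`; on top of BGSR Prop. 5.1 (`GoodConfigurations`, `GoodConfigurationsMeasure`) and of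
the free stretches of `HardSphereFreeStretch`.)

BGSR Proposition 5.3 (p. 18): *"Fix `J`, `m ∈ ℳ_J` and `T ∈ 𝒯_{J,δ}(h)`. Let the pseudo-trajectories
`Z_i = (X_i, V_i)`, `Z⁰_i = (X⁰_i, V_i)` be defined inductively by choosing at each collision
time `t_i` a deflection angle `ν_{i+1}` and a velocity `v_{i+1}` such that
`(ν_{i+1}, v_{i+1}) ∈ (S^{d-1} × B_E) ∖ ℬ^{m_i}_i(Z⁰_i(t_i))` and `∑_{k ≤ i+1} v_k² < E²`. The
velocities of both pseudo-trajectories coincide as well as the positions `x_1(u) = x_1⁰(u)` for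
`u ∈ [0, t]`. Furthermore, for `ε` sufficiently small, `∀ i ≤ J_K - 1, ∀ ℓ ≤ i + 1,
|x_ℓ(t_{i+1}) - x_ℓ⁰(t_{i+1})| ≤ ε i` (5.15)."* Its proof is the induction with hypothesis
(5.16) *"`Z⁰_i(t_i) ∈ 𝒢_i(ε₀)` and `∀ ℓ ≤ i, |x_ℓ(t_i) - x⁰_ℓ(t_i)| ≤ ε(i-1)`,
`v_ℓ(t_i) = v⁰_ℓ(t_i)`"*, whose step is Proposition 5.1: outside the bad set the BBGKY
pseudo-trajectory flies freely backwards ((5.10)/(5.12): "Proposition 5.1 implies that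
backwards in time, there is free flow for `Z_{i+1}`", (5.14)) and after the delay `δ` both
configurations are good again ((5.11)/(5.13)).

This file formalises the induction hypothesis (5.16) as a RELATION between configurations of
the two hierarchies and proves its propagation:

* §1 `IsHardSphereTrajectory.eq_freeFlight_neg_collidePair`,
  `HardSphereFlow.flow_neg_eq_freeFlight_collidePair` — **the backward hard-sphere flow issued
  from an outgoing contact configuration is the free flight of its incoming partner** as long as
  that free flight meets no contact (the transports of the iterated Duhamel formula read at
  outgoing representatives, `HardSphereHierarchyModel`, ARE BGSR's pseudo-trajectories (5.2):
  "immediate collision back to the incoming configuration, then free flight"); any geometry with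
  continuous translations over a Hausdorff position space.
* §2 torus helpers: `flightDist` along free flights, its Lipschitz bound in time and the passage
  to the limit `u → 0⁺` in (5.10)/(5.12) (`le_flightDist_zero_of_Ioc`), speeds of a configuration
  of energy `≤ E²/2`, every one-particle configuration is a good point of the Alexander flow.
* §3 the relations: `bgsrReadyPairs` ((5.16): same velocities, positions `kε`-close, same
  position of the tagged particle, the Boltzmann configuration in `𝒢_k(ε₀)` for the remaining
  horizon, the BBGKY configuration a good point of the flow), the regularity predicate
  `bgsrRegular` (BGSR p. 15: "`Ψ_{i+1}` is well defined up to a set of measure 0 [Simonella]" —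
  the recursive, almost-everywhere statement that the outgoing extensions of the transported
  configuration are good points of the `(k+1)`-sphere flow, which is what reading the Duhamel
  formula along the regularised flow requires and what the comparison CONSUMES as a hypothesis),
  and `bgsrCoupledPairs` (pairs that are ready after any transport by `s ∈ [δ, σ]`); their
  stability under the transports (`bgsrRegular.transport`, `bgsrCoupledPairs_transport`) and the
  top pair `(z, z)` (`mem_bgsrCoupledPairs_self`).
* §4 **Proposition 5.3, the induction step** (`mem_bgsrCoupledPairs_gainConfig`,
  `mem_bgsrCoupledPairs_lossConfig`): for a ready pair `(Z, Y)` of energy `≤ E²/2` and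
  `(ν, v) ∈ S^{d-1} × B_E` outside `bgsrBadSet t ā ε₀ δ (3E) Y m` (and outside the null set
  where the extension is irregular), the pair (outgoing representative of the BBGKY collision
  configuration at distance `ε`, Boltzmann collision configuration at distance `0`) is coupled
  at level `k + 1`: velocities equal, offsets `≤ (k+1)ε` ("a shift of `ε` at each creation of a
  new particle"), no recollision and free backward flight for the BBGKY configuration
  (§1 + (5.10)/(5.12)), good Boltzmann configuration after `δ` ((5.11)/(5.13)).

* §5 `bgsrCoupling` — the packaging as a `HierarchyModel.Coupling` (`HierarchyComparison`) of the
  hard-sphere model `hsHierarchyModel hε hε' N` and the Boltzmann model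
  `boltzmannModel (Torus.geometry d) _ α`.

The measure-theoretic step (Props. 5.6–5.7: the collision operators of the two models on coupled
pairs, i.e. the hypothesis `Coupling.RelStep` for `bgsrCoupling`) is NOT here.

## References

* T. Bodineau, I. Gallagher, L. Saint-Raymond, *The Brownian motion as the limit of a
  deterministic system of hard-spheres*, Invent. Math. 203 (2016) 493–553 = arXiv:1305.3397v2,
  §5.1 (5.2) p. 15, §5.2.2 Prop. 5.3 (5.14)–(5.17), pp. 18–19.
* I. Gallagher, L. Saint-Raymond, B. Texier, *From Newton to Boltzmann* (2013), Lemma 14.1.1.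
* S. Simonella, *Evolution of correlation functions in the hard sphere dynamics*, J. Stat. Phys.
  155 (2014) 1191–1221 (the a.e. well-definedness of the BBGKY pseudo-trajectories, cited by
  BGSR p. 15).
-/

open MeasureTheory Metric Set Filter Topology
open scoped InnerProductSpace ENNReal

namespace Literature.MathematicalPhysics.KineticTheory

noncomputable section

open Literature.Analysis.FunctionSpaces Literature.Analysis.FunctionSpaces.Torus
open Literature.Analysis.FluidPDE Literature.Analysis.FluidPDE.Torus

/-! ## §1. Backward flow from an outgoing contact configuration -/

section ContactStretch

variable {d : Type*} [Fintype d] {X : Type*} [TopologicalSpace X] {N : ℕ} {G : Geometry d X}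
  {ε : ℝ}

/-- **Trajectory level.** Let `γ` be a hard-sphere trajectory with a collision of the pair
`(a, b)` at time `t₁` (`γ t₁` is the post-collisional, outgoing configuration, by the
right-continuity convention), and let `W := collidePair a b (γ t₁)` be its incoming partner. If
the backward free flight of `W` meets no contact at the backward times `u ∈ (0, t₁ - t₀]`, then
`γ` has no collision time in `[t₀, t₁)` and `γ u = S⁰_{-(t₁-u)} W` for all `u ∈ [t₀, t₁)`: the left
limit of `γ` at `t₁` is `W` (field `binary` and the involutivity of the elastic reflection), the
last collision before `t₁` would be a contact configuration on the backward free flight of `W`,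
and on the collision-free stretch the trajectory is the free flight whose left limit at `t₁` is
`W`. (BGSR (5.2): the pseudo-trajectory issued from a post-collisional collision configuration
is continued backwards with the scattered, pre-collisional velocities.)
[cite: BodineauGallagherSaintRaymondInvent2016, §5.1 (5.2), p. 15] -/
theorem _root_.Literature.Analysis.FluidPDE.IsHardSphereTrajectory.eq_freeFlight_neg_collidePair
    [T2Space X] {γ : ℝ → Config N d X} (h : IsHardSphereTrajectory G ε N γ)
    (hG : ∀ x : X, Continuous (G.translate x)) {t₀ t₁ : ℝ} {a b : Fin N} (hab : a ≠ b)
    (hct : γ t₁ ∈ contactSet G N ε a b)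
    (hsep : ∀ u ∈ Ioc 0 (t₁ - t₀), ∀ i j : Fin N, i ≠ j →
      ‖G.sepVec (freeFlight G (-u) (collidePair G a b (γ t₁)) i).1
        (freeFlight G (-u) (collidePair G a b (γ t₁)) j).1‖ ≠ ε) :
    ∀ u ∈ Ico t₀ t₁, γ u = freeFlight G (-(t₁ - u)) (collidePair G a b (γ t₁)) := by
  classical
  set W := collidePair G a b (γ t₁) with hW
  -- the left limit at `t₁` is the incoming partner `W`
  obtain ⟨-, zl, hzl, -, hγ⟩ := h.binary t₁ a b hab hct
  have hzlW : zl = W := by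
    rw [hW, hγ, collidePair_collidePair hab]
  -- if `(u, t₁)` is collision-free then `γ u` is the backward free flight of `W`
  have key : ∀ u < t₁, (∀ ρ ∈ Ioo u t₁, ρ ∉ collisionTimes G ε γ) →
      γ u = freeFlight G (-(t₁ - u)) W := by
    intro u hu hfree
    have hlim := h.tendsto_nhdsLT hG hu hfree
    have heq : zl = freeFlight G (t₁ - u) (γ u) := tendsto_nhds_unique hzl hlim
    rw [← hzlW, heq, ← freeFlight_add, neg_add_cancel, freeFlight_zero]
  -- no collision time in `[t₀, t₁)`
  have hfree : ∀ ρ ∈ Ico t₀ t₁, ρ ∉ collisionTimes G ε γ := by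
    intro ρ hρ hρcol
    set F : Finset ℝ := ((h.locFinite t₀ t₁).toFinset).filter fun x => x < t₁ with hF
    have hmemF : ∀ {σ : ℝ}, σ ∈ F ↔ σ ∈ collisionTimes G ε γ ∧ σ ∈ Ico t₀ t₁ := by
      intro σ
      rw [hF, Finset.mem_filter, Set.Finite.mem_toFinset]
      exact ⟨fun ⟨⟨hc, hI⟩, hl⟩ => ⟨hc, hI.1, hl⟩, fun ⟨hc, hI⟩ => ⟨⟨hc, hI.1, hI.2.le⟩, hI.2⟩⟩
    have hρF : ρ ∈ F := hmemF.2 ⟨hρcol, hρ⟩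
    have hne : F.Nonempty := ⟨ρ, hρF⟩
    set σ := F.max' hne with hσdef
    obtain ⟨hσcol, hσI⟩ := hmemF.1 (F.max'_mem hne)
    have hfree' : ∀ ρ' ∈ Ioo σ t₁, ρ' ∉ collisionTimes G ε γ := by
      intro ρ' hρ' hρ'col
      have hρ'F : ρ' ∈ F := hmemF.2 ⟨hρ'col, hσI.1.trans hρ'.1.le, hρ'.2⟩
      exact (not_lt.2 (F.le_max' ρ' hρ'F)) hρ'.1
    have hγσ := key σ hσI.2 hfree'
    obtain ⟨i, j, hij, hc⟩ := hσcol
    rw [hγσ] at hc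
    exact hsep (t₁ - σ) ⟨by linarith [hσI.2], by linarith [hσI.1]⟩ i j hij (mem_contactSet.1 hc).2
  intro u hu
  exact key u hu.2 fun ρ hρ => hfree ρ ⟨hu.1.trans hρ.1.le, hρ.2⟩

/-- **Flow level** (the form consumed by the BBGKY pseudo-trajectories read along a hard-sphere
flow at outgoing representatives): for a good point `z` of a hard-sphere flow `Φ` which is a
contact configuration of the pair `(a, b)`, with incoming partner `W = collidePair a b z`, if the
backward free flight of `W` meets no contact at the backward times `u ∈ (0, t]`, then
`Φ_{-u} z = S⁰_{-u} W` for all `u ∈ (0, t]` (group law on the good set and the trajectory-level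
statement on `[0, u]` for the orbit of `Φ_{-u} z`).
[cite: BodineauGallagherSaintRaymondInvent2016, §5.1 (5.2), p. 15] -/
theorem _root_.Literature.Analysis.FluidPDE.HardSphereFlow.flow_neg_eq_freeFlight_collidePair
    [MeasureSpace X] [T2Space X] (Φ : HardSphereFlow G ε N)
    (hG : ∀ x : X, Continuous (G.translate x)) {z : Config N d X} (hz : z ∈ Φ.good) {a b : Fin N}
    (hab : a ≠ b) (hct : z ∈ contactSet G N ε a b) {t : ℝ}
    (hsep : ∀ u ∈ Ioc 0 t, ∀ i j : Fin N, i ≠ j →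
      ‖G.sepVec (freeFlight G (-u) (collidePair G a b z) i).1
        (freeFlight G (-u) (collidePair G a b z) j).1‖ ≠ ε) :
    ∀ u ∈ Ioc 0 t, Φ.flow (-u) z = freeFlight G (-u) (collidePair G a b z) := by
  intro u hu
  set w := Φ.flow (-u) z with hw
  have hwgood : w ∈ Φ.good := Φ.mapsTo_good (-u) hz
  have htraj := Φ.isTrajectory w hwgood
  have hreach : Φ.flow u w = z := by
    rw [hw, ← Φ.flow_add u (-u) z hz, add_neg_cancel, Φ.flow_zero z hz]
  have hct' : (fun s => Φ.flow s w) u ∈ contactSet G N ε a b := by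
    show Φ.flow u w ∈ contactSet G N ε a b
    rw [hreach]; exact hct
  have key := htraj.eq_freeFlight_neg_collidePair hG (t₀ := 0) (t₁ := u) hab hct' (by
    intro u' hu' i j hij
    show ‖G.sepVec (freeFlight G (-u') (collidePair G a b (Φ.flow u w)) i).1
      (freeFlight G (-u') (collidePair G a b (Φ.flow u w)) j).1‖ ≠ ε
    rw [hreach]
    exact hsep u' ⟨hu'.1, by linarith [hu'.2, hu.2]⟩ i j hij) 0 ⟨le_rfl, hu.1⟩
  have h0 : Φ.flow 0 w = w := Φ.flow_zero w hwgood
  simp only [h0, sub_zero, hreach] at key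
  exact key

end ContactStretch

/-! ## §2. Torus helpers -/

section TorusHelpers

variable {d : Type*} [Fintype d]

/-- `flightDist` along a backward free flight: the flight distances of `S⁰_{-s} Z` at backward
time `u` are those of `Z` at backward time `u + s`. [folklore] -/
theorem flightDist_freeFlight_neg {n : ℕ} (u s : ℝ) (Z : Config n d (UnitAddTorus d)) (i j : Fin n) :
    flightDist u (freeFlight (Torus.geometry d) (-s) Z) i j = flightDist (u + s) Z i j := by
  rw [flightDist_eq_euclidDist_freeFlight, flightDist_eq_euclidDist_freeFlight, ← freeFlight_add,
    ← neg_add]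

/-- `flightDist` is Lipschitz in the time: `d_u ≤ d_{u'} + |u - u'| (‖v_i‖ + ‖v_j‖)`. [folklore] -/
theorem flightDist_le_flightDist_add {n : ℕ} (u u' : ℝ) (Z : Config n d (UnitAddTorus d)) (i j : Fin n) :
    flightDist u Z i j ≤ flightDist u' Z i j + |u - u'| * (‖(Z i).2‖ + ‖(Z j).2‖) := by
  have key : ∀ (x : UnitAddTorus d) (v : EuclideanSpace ℝ d),
      euclidDist (x - proj (u' • v)) (x - proj (u • v)) ≤ |u - u'| * ‖v‖ := by
    intro x v
    have heq : x - proj (u' • v) = (x - proj (u • v)) + proj ((u - u') • v) := by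
      rw [sub_smul, show ∀ a b : EuclideanSpace ℝ d, proj (a - b) = proj a - proj b from fun _ _ => rfl]
      abel
    rw [heq]
    refine (euclidDist_add_proj_self_le _ _).trans ?_
    rw [norm_smul, Real.norm_eq_abs]
  have h := euclidDist_sub_sub_le ((Z i).1 - proj (u' • (Z i).2)) ((Z j).1 - proj (u' • (Z j).2))
    ((Z i).1 - proj (u • (Z i).2)) ((Z j).1 - proj (u • (Z j).2))
  rw [flightDist_eq, flightDist_eq]
  have h1 := key (Z i).1 (Z i).2
  have h2 := key (Z j).1 (Z j).2
  nlinarith [h, h1, h2, abs_nonneg (u - u')]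

/-- **Passage to the limit `u → 0⁺`** in (5.10)/(5.12): if a flight distance exceeds `c` at all
backward times `u ∈ (0, s]` (`s > 0`), it is at least `c` at time `0`. [folklore] -/
theorem le_flightDist_zero_of_Ioc {n : ℕ} {c s : ℝ} (hs : 0 < s) {Z : Config n d (UnitAddTorus d)}
    {i j : Fin n} (h : ∀ u ∈ Ioc 0 s, c < flightDist u Z i j) : c ≤ flightDist 0 Z i j := by
  by_contra hlt
  rw [not_le] at hlt
  set L : ℝ := ‖(Z i).2‖ + ‖(Z j).2‖ with hL
  have hL0 : 0 ≤ L := by positivity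
  set gap : ℝ := c - flightDist 0 Z i j with hgap
  have hgap0 : 0 < gap := by rw [hgap]; linarith
  set u : ℝ := min s (gap / (L + 1)) with hu
  have hu0 : 0 < u := lt_min hs (div_pos hgap0 (by linarith))
  have hus : u ≤ s := min_le_left _ _
  have huL : u * L < gap := by
    have h1 : u ≤ gap / (L + 1) := min_le_right _ _
    have h2 : gap / (L + 1) * L < gap := by
      rw [div_mul_eq_mul_div, div_lt_iff₀ (by linarith)]
      nlinarith
    nlinarith
  have hlip := flightDist_le_flightDist_add u 0 Z i j
  rw [sub_zero, abs_of_pos hu0] at hlip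
  have := h u ⟨hu0, hus⟩
  linarith

/-- A configuration of kinetic energy `≤ E²/2` has all its speeds `≤ E`. [folklore] -/
theorem norm_vel_le_of_configEnergy_le {n : ℕ} {X : Type*} {E : ℝ} (hE : 0 ≤ E)
    {Y : Config n d X} (hH : configEnergy Y ≤ E ^ 2 / 2) (i : Fin n) : ‖(Y i).2‖ ≤ E := by
  have h := half_norm_sq_le_configEnergy Y i
  have hsq : ‖(Y i).2‖ ^ 2 ≤ E ^ 2 := by linarith
  exact (pow_le_pow_iff_left₀ (norm_nonneg _) hE two_ne_zero).1 hsq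

/-- A single particle never leaves the hard-sphere domain: its exit time is infinite. [folklore] -/
theorem freeExitTime_eq_top_of_one {X : Type*} (G : Geometry d X) (ε : ℝ) (z : Config 1 d X) :
    Alexander.freeExitTime G ε z = ∞ :=
  Alexander.freeExitTime_eq_top_iff.2 fun _ _ i j hij => absurd (Subsingleton.elim i j) hij

/-- The forward dynamics of a single particle is regular (there are no collisions). [folklore] -/
theorem fwdGood_of_one {X : Type*} (G : Geometry d X) (ε : ℝ) (z : Config 1 d X) :
    Alexander.FwdGood G ε z := by
  refine ⟨fun k hk => absurd (freeExitTime_eq_top_of_one G ε _) hk,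
    fun k t _ _ i j hij => absurd (Subsingleton.elim i j) hij, ?_⟩
  exact ENNReal.tsum_eq_top_of_eq_top ⟨0, freeExitTime_eq_top_of_one G ε _⟩

/-- **Every one-particle configuration is a good point of the Alexander flow** (no pairs, no
collisions). [folklore] -/
theorem mem_good_of_one {X : Type*} (G : Geometry d X) (ε : ℝ) (z : Config 1 d X) :
    z ∈ Alexander.good G ε := by
  refine ⟨fun i j hij => absurd (Subsingleton.elim i j) hij,
    fun i j hij => absurd (Subsingleton.elim i j) hij, fwdGood_of_one G ε z, fwdGood_of_one G ε _⟩

/-- For one particle on the torus the regularised Alexander flow is the free flight, backwards.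
[folklore] -/
theorem regFlow_neg_eq_freeFlight_of_one {ε : ℝ} (hε : 0 < ε) (hε' : ε < 2⁻¹)
    (z : Config 1 d (UnitAddTorus d)) {u : ℝ} (hu : 0 ≤ u) :
    Alexander.regFlow (Torus.geometry d) ε (-u) z = freeFlight (Torus.geometry d) (-u) z := by
  have h := (Alexander.regHardSphereFlow (d := d) hε hε' 1).flow_neg_eq_freeFlight_of_freeFlight_ne
    (z := z) (t := u) (mem_good_of_one _ ε z) (fun _ _ i j hij => absurd (Subsingleton.elim i j) hij)
    u ⟨hu, le_rfl⟩
  simpa using h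

end TorusHelpers

/-! ## §3. The coupling relations -/

section Relations

variable {d : Type*} [Fintype d]

/-- **The adjunction-ready pairs** (BGSR's induction hypothesis (5.16) at a collision time, for a
BBGKY configuration `Z` and a Boltzmann configuration `Y` of `k` particles, with remaining
backward horizon `σ`): same velocities; positions at minimal-image distance `≤ kε` ("a shift of
`ε` at each creation of a new particle", (5.15)); the tagged particle (label `0`) at the same
position ("`x_1(u) = x_1⁰(u)`"); `Y ∈ 𝒢_k(ε₀)` for the horizon `σ`; and `Z` a good point of the
`k`-sphere Alexander flow (so that the regularised transport of `HardSphereHierarchyModel` is the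
physical one). [cite: BodineauGallagherSaintRaymondInvent2016, §5.2.2 Prop. 5.3 (5.16), p. 18] -/
def bgsrReadyPairs (ε ε₀ : ℝ) (k : ℕ) (σ : ℝ) :
    Set (Config k d (UnitAddTorus d) × Config k d (UnitAddTorus d)) :=
  {p | (∀ i, (p.1 i).2 = (p.2 i).2) ∧ (∀ i, euclidDist (p.1 i).1 (p.2 i).1 ≤ k * ε) ∧
    (∀ i : Fin k, (i : ℕ) = 0 → (p.1 i).1 = (p.2 i).1) ∧
    p.2 ∈ bgsrGoodConfigs (Torus.geometry d) k ε₀ σ ∧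
    p.1 ∈ Alexander.good (N := k) (Torus.geometry d) ε}

/-- **Regularity of the BBGKY pseudo-trajectories below a configuration, to depth `n`** (BGSR
p. 15: "From [Simonella] … one can check that `Ψ_{i+1}` is well defined up to a set of measure
0"; here in the form the regularised transports of `HardSphereHierarchyModel` require): for
almost every backward time `s ∈ [0, σ]`, every label `i` and almost every deflection angle and
velocity `(ν, v)` (surface measure times Lebesgue), the outgoing representative of the gain
(resp. loss, according to the sign of `ν · (v - v_i)`) collision configuration at distance `ε`
adjoined to `Φ_{-s} Z`, whenever it lies in the hard-sphere domain, is a good point of the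
`(k+1)`-sphere Alexander flow and is itself regular to depth `n` for the remaining horizon
`σ - s`. This is CONSUMED as a hypothesis (for almost every one-particle configuration, all
depths) by the comparison of the hierarchies; it is implied by the non-singularity of the
parametrisation of the pseudo-trajectories (Simonella 2014), not proved in the tree.
[cite: BodineauGallagherSaintRaymondInvent2016, §5.1, p. 15] -/
def bgsrRegular (ε : ℝ) : ℕ → (k : ℕ) → ℝ → Config k d (UnitAddTorus d) → Prop
  | 0, _, _, _ => True
  | n + 1, k, σ, Z => ∀ᵐ s : ℝ, s ∈ Icc (0 : ℝ) σ → ∀ i : Fin k,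
      ∀ᵐ q : sphere (0 : EuclideanSpace ℝ d) 1 × EuclideanSpace ℝ d
          ∂((sphereMeasure (E := EuclideanSpace ℝ d)).prod volume),
        (0 < ⟪(q.1 : EuclideanSpace ℝ d), q.2 - (Alexander.regFlow (Torus.geometry d) ε (-s) Z i).2⟫_ℝ →
          gainConfig (Torus.geometry d) ε (Alexander.regFlow (Torus.geometry d) ε (-s) Z) i q.1 q.2 ∈
            hardSphereDomain (Torus.geometry d) (k + 1) ε →
          outRep (Torus.geometry d) k i
              (gainConfig (Torus.geometry d) ε (Alexander.regFlow (Torus.geometry d) ε (-s) Z) i q.1 q.2) ∈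
            Alexander.good (Torus.geometry d) ε ∧
          bgsrRegular ε n (k + 1) (σ - s) (outRep (Torus.geometry d) k i
            (gainConfig (Torus.geometry d) ε (Alexander.regFlow (Torus.geometry d) ε (-s) Z) i q.1 q.2))) ∧
        (⟪(q.1 : EuclideanSpace ℝ d), q.2 - (Alexander.regFlow (Torus.geometry d) ε (-s) Z i).2⟫_ℝ < 0 →
          lossConfig (Torus.geometry d) ε (Alexander.regFlow (Torus.geometry d) ε (-s) Z) i q.1 q.2 ∈
            hardSphereDomain (Torus.geometry d) (k + 1) ε →
          outRep (Torus.geometry d) k i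
              (lossConfig (Torus.geometry d) ε (Alexander.regFlow (Torus.geometry d) ε (-s) Z) i q.1 q.2) ∈
            Alexander.good (Torus.geometry d) ε ∧
          bgsrRegular ε n (k + 1) (σ - s) (outRep (Torus.geometry d) k i
            (lossConfig (Torus.geometry d) ε (Alexander.regFlow (Torus.geometry d) ε (-s) Z) i q.1 q.2)))

/-- **The coupled pairs** (the relation of `HierarchyModel.Coupling` for the hard-sphere and
Boltzmann models on `T^d`, BGSR Prop. 5.3): the BBGKY configuration is a good point of the flow,
regular to all depths for the horizon `σ`, and after any backward transport by `s ∈ [δ, σ]` —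
regularised Alexander flow for `Z`, free flight for `Y` — the pair is adjunction-ready for the
remaining horizon (Prop. 5.1: "after a short time `δ > 0` the configurations `Z_{k+1}` and
`Z⁰_{k+1}` will be again in the good sets", (5.11)/(5.13)).
[cite: BodineauGallagherSaintRaymondInvent2016, §5.2.2 Prop. 5.3 (5.16), p. 18] -/
def bgsrCoupledPairs (ε ε₀ δ : ℝ) (k : ℕ) (σ : ℝ) :
    Set (Config k d (UnitAddTorus d) × Config k d (UnitAddTorus d)) :=
  {p | p.1 ∈ Alexander.good (N := k) (Torus.geometry d) ε ∧ (∀ n, bgsrRegular ε n k σ p.1) ∧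
    ∀ s ∈ Icc δ σ, (Alexander.regFlow (Torus.geometry d) ε (-s) p.1,
      freeFlight (Torus.geometry d) (-s) p.2) ∈ bgsrReadyPairs ε ε₀ k (σ - s)}

/-- Unfolding of the regularity predicate at depth `n + 1`. [folklore] -/
theorem bgsrRegular_succ_iff {ε : ℝ} {n k : ℕ} {σ : ℝ} {Z : Config k d (UnitAddTorus d)} :
    bgsrRegular ε (n + 1) k σ Z ↔ ∀ᵐ s : ℝ, s ∈ Icc (0 : ℝ) σ → ∀ i : Fin k,
      ∀ᵐ q : sphere (0 : EuclideanSpace ℝ d) 1 × EuclideanSpace ℝ d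
          ∂((sphereMeasure (E := EuclideanSpace ℝ d)).prod volume),
        (0 < ⟪(q.1 : EuclideanSpace ℝ d), q.2 - (Alexander.regFlow (Torus.geometry d) ε (-s) Z i).2⟫_ℝ →
          gainConfig (Torus.geometry d) ε (Alexander.regFlow (Torus.geometry d) ε (-s) Z) i q.1 q.2 ∈
            hardSphereDomain (Torus.geometry d) (k + 1) ε →
          outRep (Torus.geometry d) k i
              (gainConfig (Torus.geometry d) ε (Alexander.regFlow (Torus.geometry d) ε (-s) Z) i q.1 q.2) ∈
            Alexander.good (Torus.geometry d) ε ∧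
          bgsrRegular ε n (k + 1) (σ - s) (outRep (Torus.geometry d) k i
            (gainConfig (Torus.geometry d) ε (Alexander.regFlow (Torus.geometry d) ε (-s) Z) i q.1 q.2))) ∧
        (⟪(q.1 : EuclideanSpace ℝ d), q.2 - (Alexander.regFlow (Torus.geometry d) ε (-s) Z i).2⟫_ℝ < 0 →
          lossConfig (Torus.geometry d) ε (Alexander.regFlow (Torus.geometry d) ε (-s) Z) i q.1 q.2 ∈
            hardSphereDomain (Torus.geometry d) (k + 1) ε →
          outRep (Torus.geometry d) k i
              (lossConfig (Torus.geometry d) ε (Alexander.regFlow (Torus.geometry d) ε (-s) Z) i q.1 q.2) ∈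
            Alexander.good (Torus.geometry d) ε ∧
          bgsrRegular ε n (k + 1) (σ - s) (outRep (Torus.geometry d) k i
            (lossConfig (Torus.geometry d) ε (Alexander.regFlow (Torus.geometry d) ε (-s) Z) i q.1 q.2))) :=
  Iff.rfl


/-- **Regularity to all depths, in the form consumed at one collision**: for almost every
backward time, every label and almost every `(ν, v)`, the outgoing extensions in the hard-sphere
domain are good points of the flow and regular to ALL depths (countable intersection of the
depth-`(n+1)` statements). [folklore] -/
theorem ae_of_forall_bgsrRegular {ε : ℝ} {k : ℕ} {σ : ℝ} {Z : Config k d (UnitAddTorus d)}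
    (h : ∀ n, bgsrRegular ε n k σ Z) :
    ∀ᵐ s : ℝ, s ∈ Icc (0 : ℝ) σ → ∀ i : Fin k,
      ∀ᵐ q : sphere (0 : EuclideanSpace ℝ d) 1 × EuclideanSpace ℝ d
          ∂((sphereMeasure (E := EuclideanSpace ℝ d)).prod volume),
        (0 < ⟪(q.1 : EuclideanSpace ℝ d), q.2 - (Alexander.regFlow (Torus.geometry d) ε (-s) Z i).2⟫_ℝ →
          gainConfig (Torus.geometry d) ε (Alexander.regFlow (Torus.geometry d) ε (-s) Z) i q.1 q.2 ∈
            hardSphereDomain (Torus.geometry d) (k + 1) ε →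
          outRep (Torus.geometry d) k i
              (gainConfig (Torus.geometry d) ε (Alexander.regFlow (Torus.geometry d) ε (-s) Z) i q.1 q.2) ∈
            Alexander.good (Torus.geometry d) ε ∧
          ∀ n, bgsrRegular ε n (k + 1) (σ - s) (outRep (Torus.geometry d) k i
            (gainConfig (Torus.geometry d) ε (Alexander.regFlow (Torus.geometry d) ε (-s) Z) i q.1 q.2))) ∧
        (⟪(q.1 : EuclideanSpace ℝ d), q.2 - (Alexander.regFlow (Torus.geometry d) ε (-s) Z i).2⟫_ℝ < 0 →
          lossConfig (Torus.geometry d) ε (Alexander.regFlow (Torus.geometry d) ε (-s) Z) i q.1 q.2 ∈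
            hardSphereDomain (Torus.geometry d) (k + 1) ε →
          outRep (Torus.geometry d) k i
              (lossConfig (Torus.geometry d) ε (Alexander.regFlow (Torus.geometry d) ε (-s) Z) i q.1 q.2) ∈
            Alexander.good (Torus.geometry d) ε ∧
          ∀ n, bgsrRegular ε n (k + 1) (σ - s) (outRep (Torus.geometry d) k i
            (lossConfig (Torus.geometry d) ε (Alexander.regFlow (Torus.geometry d) ε (-s) Z) i q.1 q.2))) := by
  have h' := fun n => bgsrRegular_succ_iff.1 (h (n + 1))
  rw [← ae_all_iff] at h'
  filter_upwards [h'] with s hs hsI i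
  have h2 := fun n => hs n hsI i
  rw [← ae_all_iff] at h2
  filter_upwards [h2] with q hq
  exact ⟨fun hg hd => ⟨((hq 0).1 hg hd).1, fun n => ((hq n).1 hg hd).2⟩,
    fun hl hd => ⟨((hq 0).2 hl hd).1, fun n => ((hq n).2 hl hd).2⟩⟩

/-- **Regularity is stable under the backward transport**: if `Z` is regular to depth `n` for
the horizon `σ`, then `Φ_{-s₀} Z` is regular to depth `n` for the horizon `σ - s₀`
(`s₀ ∈ [0, σ]`; group law of the regularised flow and translation invariance of Lebesgue
measure on the time axis). [folklore] -/
theorem bgsrRegular.transport {ε : ℝ} (hε : 0 < ε) (hε' : ε < 2⁻¹) :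
    ∀ {n k : ℕ} {σ : ℝ} {Z : Config k d (UnitAddTorus d)}, bgsrRegular ε n k σ Z →
      ∀ {s₀ : ℝ}, s₀ ∈ Icc 0 σ →
        bgsrRegular ε n k (σ - s₀) (Alexander.regFlow (Torus.geometry d) ε (-s₀) Z) := by
  intro n
  cases n with
  | zero => intro k σ Z _ s₀ _; trivial
  | succ n =>
    intro k σ Z h s₀ hs₀
    rw [bgsrRegular_succ_iff] at h ⊢
    have hqmp := (measurePreserving_add_right (volume : Measure ℝ) s₀).quasiMeasurePreserving
    filter_upwards [hqmp.ae h] with s' hs' hs'I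
    have hsI : s' + s₀ ∈ Icc 0 σ := ⟨by linarith [hs'I.1, hs₀.1], by linarith [hs'I.2]⟩
    have hflow : Alexander.regFlow (Torus.geometry d) ε (-s')
        (Alexander.regFlow (Torus.geometry d) ε (-s₀) Z) =
        Alexander.regFlow (Torus.geometry d) ε (-(s' + s₀)) Z := by
      rw [neg_add, Alexander.regFlow_add hε hε']
    have hσ : σ - s₀ - s' = σ - (s' + s₀) := by ring
    simp only [hflow, hσ]
    exact hs' hsI

/-- **Coupled pairs are stable under the two transports** (the field `trans` of
`HierarchyModel.Coupling`): transporting a coupled pair of horizon `σ` by `s ∈ [δ, σ]` (`δ ≥ 0`)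
gives a coupled pair of horizon `σ - s` (group laws of the regularised flow and of the free
flight, invariance of the good set). [cite: BodineauGallagherSaintRaymondInvent2016, §5.2.2 Prop. 5.3, p. 18] -/
theorem bgsrCoupledPairs_transport {ε ε₀ δ : ℝ} (hε : 0 < ε) (hε' : ε < 2⁻¹) (hδ : 0 ≤ δ) {k : ℕ}
    {σ : ℝ} {p : Config k d (UnitAddTorus d) × Config k d (UnitAddTorus d)}
    (hp : p ∈ bgsrCoupledPairs ε ε₀ δ k σ) {s : ℝ} (hs : s ∈ Icc δ σ) :
    (Alexander.regFlow (Torus.geometry d) ε (-s) p.1, freeFlight (Torus.geometry d) (-s) p.2) ∈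
      bgsrCoupledPairs ε ε₀ δ k (σ - s) := by
  obtain ⟨hgood, hreg, hready⟩ := hp
  have hs0 : s ∈ Icc 0 σ := ⟨hδ.trans hs.1, hs.2⟩
  refine ⟨Alexander.mapsTo_regFlow_good hε hε' (-s) hgood, fun n => (hreg n).transport hε hε' hs0,
    fun s' hs' => ?_⟩
  have h := hready (s' + s) ⟨by linarith [hs'.1, hs.1], by linarith [hs'.2]⟩
  rw [neg_add, Alexander.regFlow_add hε hε', freeFlight_add] at h
  convert h using 2
  ring

/-- **The top pair**: a one-particle configuration, regular to all depths for the horizon `σ`, is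
coupled with itself (`ε ≥ 0`): one particle is a good point of the flow, its regularised
transport is the free flight, and a single particle is vacuously in `𝒢_1(ε₀)` (BGSR: "The
initial configuration containing only one particle, there is no possible recollision!").
[cite: BodineauGallagherSaintRaymondInvent2016, §5.2.2 Prop. 5.3 proof, p. 18] -/
theorem mem_bgsrCoupledPairs_self {ε ε₀ δ : ℝ} (hε : 0 < ε) (hε' : ε < 2⁻¹) (hδ : 0 ≤ δ) {σ : ℝ}
    {z : Config 1 d (UnitAddTorus d)} (hreg : ∀ n, bgsrRegular ε n 1 σ z) :
    (z, z) ∈ bgsrCoupledPairs ε ε₀ δ 1 σ := by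
  refine ⟨mem_good_of_one _ ε z, hreg, fun s hs => ?_⟩
  have hs0 : 0 ≤ s := hδ.trans hs.1
  rw [regFlow_neg_eq_freeFlight_of_one hε hε' z hs0]
  refine ⟨fun i => rfl, fun i => ?_, fun i _ => rfl, fun u _ i j hij => absurd (Subsingleton.elim i j) hij,
    ?_⟩
  · rw [euclidDist_self]; push_cast; linarith
  · rw [← regFlow_neg_eq_freeFlight_of_one hε hε' z hs0]
    exact Alexander.mapsTo_regFlow_good hε hε' (-s) (mem_good_of_one _ ε z)

end Relations

/-! ## §4. Proposition 5.3: the induction step -/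

section Components

variable {d : Type*} [Fintype d] {X : Type*} {s : ℕ} (G : Geometry d X) (ε : ℝ)
  (Zs : Config s d X) (i : Fin s) (ω v : EuclideanSpace ℝ d)

/-- The old particles of the loss configuration. [folklore] -/
@[simp]
theorem lossConfig_apply_castAdd (j : Fin s) : lossConfig G ε Zs i ω v (Fin.castAdd 1 j) = Zs j := by
  simp [lossConfig]

/-- The adjoined particle of the loss configuration. [folklore] -/
@[simp]
theorem lossConfig_apply_last :
    lossConfig G ε Zs i ω v (Fin.natAdd s 0) = (G.translate (Zs i).1 (ε • ω), v) := by
  simp [lossConfig]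

/-- The old particles of the gain configuration (the partner `i` carries the scattered
velocity). [folklore] -/
theorem gainConfig_apply_castAdd (j : Fin s) :
    gainConfig G ε Zs i ω v (Fin.castAdd 1 j) =
      Function.update Zs i ((Zs i).1, (reflectVel ω ((Zs i).2, v)).1) j := by
  simp [gainConfig]

/-- The adjoined particle of the gain configuration. [folklore] -/
@[simp]
theorem gainConfig_apply_last :
    gainConfig G ε Zs i ω v (Fin.natAdd s 0) =
      (G.translate (Zs i).1 (ε • ω), (reflectVel ω ((Zs i).2, v)).2) := by
  simp [gainConfig]

/-- The positions of the old particles of the gain configuration are unchanged. [folklore] -/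
@[simp]
theorem gainConfig_apply_castAdd_fst (j : Fin s) :
    (gainConfig G ε Zs i ω v (Fin.castAdd 1 j)).1 = (Zs j).1 := by
  rw [gainConfig_apply_castAdd]
  by_cases h : j = i
  · subst h; simp
  · simp [h]

/-- The velocities of the old particles of the gain configuration. [folklore] -/
theorem gainConfig_apply_castAdd_snd (j : Fin s) :
    (gainConfig G ε Zs i ω v (Fin.castAdd 1 j)).2 =
      if j = i then (reflectVel ω ((Zs i).2, v)).1 else (Zs j).2 := by
  rw [gainConfig_apply_castAdd]
  by_cases h : j = i
  · subst h; simp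
  · simp [h]

variable {G ε Zs i ω v}

/-- Two gain configurations built on configurations with the same velocities have the same
velocities (whatever the diameters). [folklore] -/
theorem gainConfig_snd_eq {Ys : Config s d X} (hvel : ∀ j, (Zs j).2 = (Ys j).2) (ε₁ ε₂ : ℝ) :
    ∀ j, (gainConfig G ε₁ Zs i ω v j).2 = (gainConfig G ε₂ Ys i ω v j).2 := by
  intro j
  induction j using Fin.addCases with
  | left j => rw [gainConfig_apply_castAdd_snd, gainConfig_apply_castAdd_snd, hvel i, hvel j]
  | right j =>
    obtain rfl : j = 0 := Fin.fin_one_eq_zero j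
    rw [gainConfig_apply_last, gainConfig_apply_last, hvel i]

/-- Two loss configurations built on configurations with the same velocities have the same
velocities. [folklore] -/
theorem lossConfig_snd_eq {Ys : Config s d X} (hvel : ∀ j, (Zs j).2 = (Ys j).2) (ε₁ ε₂ : ℝ) :
    ∀ j, (lossConfig G ε₁ Zs i ω v j).2 = (lossConfig G ε₂ Ys i ω v j).2 := by
  intro j
  induction j using Fin.addCases with
  | left j => rw [lossConfig_apply_castAdd, lossConfig_apply_castAdd, hvel j]
  | right j =>
    obtain rfl : j = 0 := Fin.fin_one_eq_zero j
    rw [lossConfig_apply_last, lossConfig_apply_last]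

end Components

section Step

variable {d : Type*} [Fintype d] [DecidableEq d]

omit [DecidableEq d] in
/-- Translating both points of the torus by the free flight of a common velocity does not change
their minimal-image distance. [folklore] -/
theorem euclidDist_translate_eq (x y : UnitAddTorus d) (a : EuclideanSpace ℝ d) :
    euclidDist ((Torus.geometry d).translate x a) ((Torus.geometry d).translate y a) = euclidDist x y := by
  rw [Torus.geometry_translate, Torus.geometry_translate, euclidDist_add_right]

/-- The label `0` of `Fin (k + 1)` is an old label as soon as `k ≥ 1`. [folklore] -/
theorem eq_castAdd_of_val_eq_zero {k : ℕ} (hk : 0 < k) {j : Fin (k + 1)} (hj : (j : ℕ) = 0) :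
    j = Fin.castAdd 1 ⟨0, hk⟩ :=
  Fin.ext hj

/-- **BGSR Proposition 5.3, induction step, post-collisional (gain) case.** Let `(Z, Y)` be an
adjunction-ready pair of `k`-particle configurations for the horizon `σ' ≤ t` (same velocities,
positions `kε`-close, `Y ∈ 𝒢_k(ε₀)`), of energy `H(Y) ≤ E²/2`, with `(k+1)ε ≤ ā`, `4ā ≤ ε₀`,
`0 < δ`, `0 < ε < 1/2`; adjoin a particle with deflection angle `ν ∈ S^{d-1}` and velocity
`v ∈ B_E` in a post-collisional configuration `ν · (v - v_m) > 0`, with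
`(ν, v) ∉ bgsrBadSet t ā ε₀ δ (3E) Y m`, and assume the outgoing representative `Z♯` of the BBGKY
collision configuration `gainConfig ε Z m ν v` is a good point of the `(k+1)`-sphere flow,
regular to all depths. Then `(Z♯, gainConfig 0 Y m ν v)` is a coupled pair at level `k + 1` for
the horizon `σ'`: by (5.12) the backward free flight of the collision configuration meets no
contact on `(0, σ']`, so the regularised flow issued from `Z♯` is that free flight
(`HardSphereFlow.flow_neg_eq_freeFlight_collidePair`); velocities coincide, positions stay
`(k+1)ε`-close and the tagged particle at the same position; by (5.13) the Boltzmann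
configuration is in `𝒢_{k+1}(ε₀)` after the delay `δ`.
[cite: BodineauGallagherSaintRaymondInvent2016, §5.2.2 Prop. 5.3, pp. 18–19] -/
theorem mem_bgsrCoupledPairs_gainConfig {ε : ℝ} (hε : 0 < ε) (hε' : ε < 2⁻¹) {k : ℕ}
    {t σ' ā ε₀ δ E : ℝ} {Z Y : Config k d (UnitAddTorus d)} {m : Fin k} {ω v : EuclideanSpace ℝ d}
    (hkε : (k + 1 : ℝ) * ε ≤ ā) (hāε₀ : 4 * ā ≤ ε₀) (hδ : 0 < δ) (hσ't : σ' ≤ t)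
    (hready : (Z, Y) ∈ bgsrReadyPairs ε ε₀ k σ') (hHE : configEnergy Y ≤ E ^ 2 / 2) (hE : 0 ≤ E)
    (hvE : ‖v‖ ≤ E) (hω : ‖ω‖ = 1) (hsign : 0 < ⟪ω, v - (Y m).2⟫_ℝ)
    (hbad : (ω, v) ∉ bgsrBadSet t ā ε₀ δ (3 * E) Y m)
    (hgood : outRep (Torus.geometry d) k m (gainConfig (Torus.geometry d) ε Z m ω v) ∈
      Alexander.good (Torus.geometry d) ε)
    (hreg : ∀ n, bgsrRegular ε n (k + 1) σ'
      (outRep (Torus.geometry d) k m (gainConfig (Torus.geometry d) ε Z m ω v))) :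
    (outRep (Torus.geometry d) k m (gainConfig (Torus.geometry d) ε Z m ω v),
      gainConfig (Torus.geometry d) 0 Y m ω v) ∈ bgsrCoupledPairs ε ε₀ δ (k + 1) σ' := by
  obtain ⟨hvel, hpos, hx0, hY, -⟩ := hready
  have hk1 : (k : ℝ) * ε ≤ (k + 1) * ε := by nlinarith [hε.le]
  have hā : ∀ j, euclidDist (Z j).1 (Y j).1 ≤ ā := fun j => (hpos j).trans (hk1.trans hkε)
  have hεā : ε ≤ ā := le_trans (by nlinarith [hε.le, (Nat.cast_nonneg k : (0 : ℝ) ≤ k)]) hkε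
  have hε₀ : 0 ≤ ε₀ := by linarith
  have hspeed : ∀ j, ‖(Y j).2‖ ≤ E := norm_vel_le_of_configEnergy_le hE hHE
  have hEW : 3 * E ≤ 3 * E := le_rfl
  obtain ⟨-, hpost⟩ := not_mem_bgsrBadSet_iff.1 hbad
  set W := gainConfig (Torus.geometry d) ε Z m ω v with hWdef
  set W₀ := gainConfig (Torus.geometry d) 0 Y m ω v with hW₀def
  set Zs := outRep (Torus.geometry d) k m W with hZsdef
  -- (5.12): no recollision along the backward free flight of `W`
  have hfl : ∀ u ∈ Ioc 0 σ', ∀ p q : Fin (k + 1), p ≠ q → ε < flightDist u W p q :=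
    fun u hu p q hpq => bgsr_prop51_post_bbgky hε hεā hāε₀ hσ't hEW hY hvel hā hspeed hvE hω hsign
      hpost hu.1 hu.2 hpq
  -- (5.13): the Boltzmann configuration is good after `δ`
  have hW₀ : ∀ u, δ ≤ u → u ≤ σ' → ∀ p q : Fin (k + 1), p ≠ q → ε₀ ≤ flightDist u W₀ p q :=
    fun u hδu hus p q hpq => bgsr_prop51_post_boltzmann_delta hε₀ hδ hσ't hEW hY hspeed hvE hω hpost
      hδu hus hpq
  refine ⟨hgood, hreg, fun s' hs' => ?_⟩
  have hσ'0 : 0 < σ' := hδ.trans_le (hs'.1.trans hs'.2)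
  have hab := castAdd_ne_natAdd (s := k) m
  have hcol : collidePair (Torus.geometry d) (Fin.castAdd 1 m) (Fin.natAdd k 0) Zs = W :=
    collidePair_collidePair hab W
  -- positions of `W`
  have hWa : (W (Fin.castAdd 1 m)).1 = (Z m).1 := gainConfig_apply_castAdd_fst _ _ _ _ _ _ _
  have hWb : (W (Fin.natAdd k 0)).1 = (Z m).1 + proj (ε • ω) := by
    rw [hWdef, gainConfig_apply_last, Torus.geometry_translate]
  -- `W` is in the hard-sphere domain and its pair `(m, k+1)` is in contact
  have hdom : W ∈ hardSphereDomain (Torus.geometry d) (k + 1) ε := by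
    intro p q hpq
    rw [Torus.norm_geometry_sepVec, ← flightDist_zero]
    exact le_flightDist_zero_of_Ioc hσ'0 fun u hu => hfl u hu p q hpq
  have hct : Zs ∈ contactSet (Torus.geometry d) (k + 1) ε (Fin.castAdd 1 m) (Fin.natAdd k 0) := by
    refine ⟨(outRep_mem_hardSphereDomain_iff m W).2 hdom, ?_⟩
    rw [hZsdef, outRep, collidePair_apply_fst, collidePair_apply_fst, hWa, hWb,
      Torus.norm_geometry_sepVec]
    apply le_antisymm
    · rw [euclidDist_comm]
      calc euclidDist ((Z m).1 + proj (ε • ω)) (Z m).1 ≤ ‖ε • ω‖ := euclidDist_add_proj_self_le _ _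
        _ = ε := by rw [norm_smul, hω, mul_one, Real.norm_of_nonneg hε.le]
    · have h := hdom (Fin.castAdd 1 m) (Fin.natAdd k 0) hab
      rwa [Torus.norm_geometry_sepVec, hWa, hWb] at h
  -- the backward flow issued from `Zs` is the free flight of `W` on `(0, σ']`
  have hflow : ∀ u ∈ Ioc 0 σ', Alexander.regFlow (Torus.geometry d) ε (-u) Zs =
      freeFlight (Torus.geometry d) (-u) W := by
    intro u hu
    have h := (Alexander.regHardSphereFlow (d := d) hε hε' (k + 1)).flow_neg_eq_freeFlight_collidePair
      Torus.continuous_geometry_translate (z := Zs) hgood hab hct (t := σ') (by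
        intro u' hu' p q hpq
        rw [hcol, Torus.norm_geometry_sepVec, ← flightDist_eq_euclidDist_freeFlight]
        exact (hfl u' hu' p q hpq).ne') u hu
    rwa [hcol, Alexander.regHardSphereFlow_flow] at h
  have hs'I : s' ∈ Ioc 0 σ' := ⟨hδ.trans_le hs'.1, hs'.2⟩
  have hvelW : ∀ j, (W j).2 = (W₀ j).2 := gainConfig_snd_eq hvel ε 0
  have hk : 0 < k := Fin.pos m
  rw [hflow s' hs'I]
  refine ⟨fun j => by simp [freeFlight_apply, hvelW j], fun j => ?_, fun j hj => ?_, ?_, ?_⟩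
  · -- positions stay `(k+1)ε`-close
    dsimp only
    rw [freeFlight_apply, freeFlight_apply, hvelW j, euclidDist_translate_eq]
    induction j using Fin.addCases with
    | left j =>
      rw [hWdef, hW₀def, gainConfig_apply_castAdd_fst, gainConfig_apply_castAdd_fst]
      push_cast
      exact (hpos j).trans hk1
    | right j =>
      obtain rfl : j = 0 := Fin.fin_one_eq_zero j
      rw [hWdef, hW₀def, gainConfig_apply_last, gainConfig_apply_last, Torus.geometry_translate,
        Torus.geometry_translate, zero_smul, proj_zero, add_zero]
      push_cast
      calc euclidDist ((Z m).1 + proj (ε • ω)) (Y m).1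
          ≤ euclidDist ((Z m).1 + proj (ε • ω)) (Z m).1 + euclidDist (Z m).1 (Y m).1 :=
            torus_euclidDist_triangle _ _ _
        _ ≤ ‖ε • ω‖ + k * ε := add_le_add (euclidDist_add_proj_self_le _ _) (hpos m)
        _ = (k + 1) * ε := by rw [norm_smul, hω, mul_one, Real.norm_of_nonneg hε.le]; ring
  · -- the tagged particle
    obtain rfl := eq_castAdd_of_val_eq_zero hk hj
    have hx0' : (Z ⟨0, hk⟩).1 = (Y ⟨0, hk⟩).1 := hx0 ⟨0, hk⟩ rfl
    dsimp only
    rw [freeFlight_apply, freeFlight_apply, hvelW]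
    dsimp only
    rw [hWdef, hW₀def, gainConfig_apply_castAdd_fst, gainConfig_apply_castAdd_fst, hx0']
  · -- the Boltzmann configuration is good for the remaining horizon
    rw [mem_bgsrGoodConfigs_torus_iff]
    intro u hu p q hpq
    rw [flightDist_freeFlight_neg]
    exact hW₀ (u + s') (by linarith [hu.1, hs'.1]) (by linarith [hu.2]) p q hpq
  · -- the BBGKY configuration is a good point of the flow
    rw [← hflow s' hs'I]
    exact Alexander.mapsTo_regFlow_good hε hε' (-s') hgood

/-- **BGSR Proposition 5.3, induction step, pre-collisional (loss) case**: the same with the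
loss configurations `lossConfig ε Z m ν v`, `lossConfig 0 Y m ν v` in a pre-collisional
configuration `ν · (v - v_m) < 0` ((5.10)/(5.11) in place of (5.12)/(5.13)).
[cite: BodineauGallagherSaintRaymondInvent2016, §5.2.2 Prop. 5.3, pp. 18–19] -/
theorem mem_bgsrCoupledPairs_lossConfig {ε : ℝ} (hε : 0 < ε) (hε' : ε < 2⁻¹) {k : ℕ}
    {t σ' ā ε₀ δ E : ℝ} {Z Y : Config k d (UnitAddTorus d)} {m : Fin k} {ω v : EuclideanSpace ℝ d}
    (hkε : (k + 1 : ℝ) * ε ≤ ā) (hāε₀ : 4 * ā ≤ ε₀) (hδ : 0 < δ) (hσ't : σ' ≤ t)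
    (hready : (Z, Y) ∈ bgsrReadyPairs ε ε₀ k σ') (hHE : configEnergy Y ≤ E ^ 2 / 2) (hE : 0 ≤ E)
    (hvE : ‖v‖ ≤ E) (hω : ‖ω‖ = 1) (hsign : ⟪ω, v - (Y m).2⟫_ℝ < 0)
    (hbad : (ω, v) ∉ bgsrBadSet t ā ε₀ δ (3 * E) Y m)
    (hgood : outRep (Torus.geometry d) k m (lossConfig (Torus.geometry d) ε Z m ω v) ∈
      Alexander.good (Torus.geometry d) ε)
    (hreg : ∀ n, bgsrRegular ε n (k + 1) σ'
      (outRep (Torus.geometry d) k m (lossConfig (Torus.geometry d) ε Z m ω v))) :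
    (outRep (Torus.geometry d) k m (lossConfig (Torus.geometry d) ε Z m ω v),
      lossConfig (Torus.geometry d) 0 Y m ω v) ∈ bgsrCoupledPairs ε ε₀ δ (k + 1) σ' := by
  obtain ⟨hvel, hpos, hx0, hY, -⟩ := hready
  have hk1 : (k : ℝ) * ε ≤ (k + 1) * ε := by nlinarith [hε.le]
  have hā : ∀ j, euclidDist (Z j).1 (Y j).1 ≤ ā := fun j => (hpos j).trans (hk1.trans hkε)
  have hεā : ε ≤ ā := le_trans (by nlinarith [hε.le, (Nat.cast_nonneg k : (0 : ℝ) ≤ k)]) hkε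
  have hε₀ : 0 ≤ ε₀ := by linarith
  have hspeed : ∀ j, ‖(Y j).2‖ ≤ E := norm_vel_le_of_configEnergy_le hE hHE
  have hEW : 2 * E ≤ 3 * E := by linarith
  obtain ⟨hpre, -⟩ := not_mem_bgsrBadSet_iff.1 hbad
  set W := lossConfig (Torus.geometry d) ε Z m ω v with hWdef
  set W₀ := lossConfig (Torus.geometry d) 0 Y m ω v with hW₀def
  set Zs := outRep (Torus.geometry d) k m W with hZsdef
  -- (5.10): no recollision along the backward free flight of `W`
  have hfl : ∀ u ∈ Ioc 0 σ', ∀ p q : Fin (k + 1), p ≠ q → ε < flightDist u W p q :=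
    fun u hu p q hpq => bgsr_prop51_pre_bbgky hε hεā hāε₀ hσ't hEW hY hvel hā hspeed hvE hω hsign
      hpre hu.1 hu.2 hpq
  -- (5.11): the Boltzmann configuration is good after `δ`
  have hW₀ : ∀ u, δ ≤ u → u ≤ σ' → ∀ p q : Fin (k + 1), p ≠ q → ε₀ ≤ flightDist u W₀ p q :=
    fun u hδu hus p q hpq => bgsr_prop51_pre_boltzmann_delta hε₀ hδ hσ't hEW hY hspeed hvE hpre
      hδu hus hpq
  refine ⟨hgood, hreg, fun s' hs' => ?_⟩
  have hσ'0 : 0 < σ' := hδ.trans_le (hs'.1.trans hs'.2)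
  have hab := castAdd_ne_natAdd (s := k) m
  have hcol : collidePair (Torus.geometry d) (Fin.castAdd 1 m) (Fin.natAdd k 0) Zs = W :=
    collidePair_collidePair hab W
  have hWa : (W (Fin.castAdd 1 m)).1 = (Z m).1 := by rw [hWdef, lossConfig_apply_castAdd]
  have hWb : (W (Fin.natAdd k 0)).1 = (Z m).1 + proj (ε • ω) := by
    rw [hWdef, lossConfig_apply_last, Torus.geometry_translate]
  have hdom : W ∈ hardSphereDomain (Torus.geometry d) (k + 1) ε := by
    intro p q hpq
    rw [Torus.norm_geometry_sepVec, ← flightDist_zero]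
    exact le_flightDist_zero_of_Ioc hσ'0 fun u hu => hfl u hu p q hpq
  have hct : Zs ∈ contactSet (Torus.geometry d) (k + 1) ε (Fin.castAdd 1 m) (Fin.natAdd k 0) := by
    refine ⟨(outRep_mem_hardSphereDomain_iff m W).2 hdom, ?_⟩
    rw [hZsdef, outRep, collidePair_apply_fst, collidePair_apply_fst, hWa, hWb,
      Torus.norm_geometry_sepVec]
    apply le_antisymm
    · rw [euclidDist_comm]
      calc euclidDist ((Z m).1 + proj (ε • ω)) (Z m).1 ≤ ‖ε • ω‖ := euclidDist_add_proj_self_le _ _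
        _ = ε := by rw [norm_smul, hω, mul_one, Real.norm_of_nonneg hε.le]
    · have h := hdom (Fin.castAdd 1 m) (Fin.natAdd k 0) hab
      rwa [Torus.norm_geometry_sepVec, hWa, hWb] at h
  have hflow : ∀ u ∈ Ioc 0 σ', Alexander.regFlow (Torus.geometry d) ε (-u) Zs =
      freeFlight (Torus.geometry d) (-u) W := by
    intro u hu
    have h := (Alexander.regHardSphereFlow (d := d) hε hε' (k + 1)).flow_neg_eq_freeFlight_collidePair
      Torus.continuous_geometry_translate (z := Zs) hgood hab hct (t := σ') (by
        intro u' hu' p q hpq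
        rw [hcol, Torus.norm_geometry_sepVec, ← flightDist_eq_euclidDist_freeFlight]
        exact (hfl u' hu' p q hpq).ne') u hu
    rwa [hcol, Alexander.regHardSphereFlow_flow] at h
  have hs'I : s' ∈ Ioc 0 σ' := ⟨hδ.trans_le hs'.1, hs'.2⟩
  have hvelW : ∀ j, (W j).2 = (W₀ j).2 := lossConfig_snd_eq hvel ε 0
  have hk : 0 < k := Fin.pos m
  rw [hflow s' hs'I]
  refine ⟨fun j => by simp [freeFlight_apply, hvelW j], fun j => ?_, fun j hj => ?_, ?_, ?_⟩
  · dsimp only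
    rw [freeFlight_apply, freeFlight_apply, hvelW j, euclidDist_translate_eq]
    induction j using Fin.addCases with
    | left j =>
      rw [hWdef, hW₀def, lossConfig_apply_castAdd, lossConfig_apply_castAdd]
      push_cast
      exact (hpos j).trans hk1
    | right j =>
      obtain rfl : j = 0 := Fin.fin_one_eq_zero j
      rw [hWdef, hW₀def, lossConfig_apply_last, lossConfig_apply_last, Torus.geometry_translate,
        Torus.geometry_translate, zero_smul, proj_zero, add_zero]
      push_cast
      calc euclidDist ((Z m).1 + proj (ε • ω)) (Y m).1
          ≤ euclidDist ((Z m).1 + proj (ε • ω)) (Z m).1 + euclidDist (Z m).1 (Y m).1 :=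
            torus_euclidDist_triangle _ _ _
        _ ≤ ‖ε • ω‖ + k * ε := add_le_add (euclidDist_add_proj_self_le _ _) (hpos m)
        _ = (k + 1) * ε := by rw [norm_smul, hω, mul_one, Real.norm_of_nonneg hε.le]; ring
  · obtain rfl := eq_castAdd_of_val_eq_zero hk hj
    have hx0' : (Z ⟨0, hk⟩).1 = (Y ⟨0, hk⟩).1 := hx0 ⟨0, hk⟩ rfl
    dsimp only
    rw [freeFlight_apply, freeFlight_apply, hvelW]
    dsimp only
    rw [hWdef, hW₀def, lossConfig_apply_castAdd, lossConfig_apply_castAdd, hx0']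
  · rw [mem_bgsrGoodConfigs_torus_iff]
    intro u hu p q hpq
    rw [flightDist_freeFlight_neg]
    exact hW₀ (u + s') (by linarith [hu.1, hs'.1]) (by linarith [hu.2]) p q hpq
  · rw [← hflow s' hs'I]
    exact Alexander.mapsTo_regFlow_good hε hε' (-s') hgood

end Step

/-! ## §5. The coupling of the two hierarchy models -/

section CouplingInstance

variable {d : Type*} [Fintype d]

/-- **The coupling of the hard-sphere and Boltzmann hierarchy models on `T^d`** (BGSR Prop. 5.3
as a `HierarchyModel.Coupling`): the relation `bgsrCoupledPairs ε ε₀ δ` between the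
`k`-particle configurations of the BBGKY hierarchy of `N` hard spheres of diameter `ε`
(`hsHierarchyModel`: regularised Alexander flows, outgoing collision operators) and of the
Boltzmann hierarchy with rate `α` (`boltzmannModel`: free flight), stable under the two backward
transports (`bgsrCoupledPairs_transport`). [cite: BodineauGallagherSaintRaymondInvent2016, §5.2.2 Prop. 5.3, p. 18] -/
def bgsrCoupling {ε : ℝ} (hε : 0 < ε) (hε' : ε < 2⁻¹) (N : ℕ) (α ε₀ : ℝ) {δ : ℝ} (hδ : 0 ≤ δ) :
    (hsHierarchyModel (d := d) hε hε' N).Coupling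
      (boltzmannModel (Torus.geometry d) measurable_translate_torus α) δ where
  rel := fun k σ => bgsrCoupledPairs ε ε₀ δ k σ
  trans := fun _ _ _ hp _ hs => bgsrCoupledPairs_transport hε hε' hδ hp hs

/-- The relation of `bgsrCoupling` is `bgsrCoupledPairs`. [folklore] -/
@[simp]
theorem bgsrCoupling_rel {ε : ℝ} (hε : 0 < ε) (hε' : ε < 2⁻¹) (N : ℕ) (α ε₀ : ℝ) {δ : ℝ}
    (hδ : 0 ≤ δ) (k : ℕ) (σ : ℝ) :
    (bgsrCoupling (d := d) hε hε' N α ε₀ hδ).rel k σ = bgsrCoupledPairs ε ε₀ δ k σ := rfl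

end CouplingInstance

end

end Literature.MathematicalPhysics.KineticTheory
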